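import Summits.Ventures.YMGap.RobustBall.StarDoorZdGeometric
import HarnessLib

/-!
# Venture YMGap, track ROBUST-BALL (Y2) — the vertex-star door at the geometric rate WITHOUT THE `½` FLOOR:
# rate `log(1/ρ₀)/(D+2)` with constant `8N/ρ₀` (sharper than `log(1/max(ρ₀,½))`, `16N` whenever `ρ₀ < ½`)

HONEST FRAMING. WHAT THIS IS: a venture file (cell `pub-ymgap`, track Y2 ROBUST-BALL, seat rb-p1, theorems only), the sharpening
asked for in rb-ref RB-371 (5): in `StarDoorZdGeometric.lean` the floor-rounding loss `ρ^{⌊x⌋} ≤ ρ^{x−1}` was absorbed by capping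
the received sum below at `½` (`1/max(ρ,½) ≤ 2` into the constant `16N`), which saturates the RATE at `log 2` per locality radius for
every certificate with `ρ₀ < ½`.  Keeping `1/ρ` in the CONSTANT instead gives, for `0 < ρ < 1`,
* `perturbedClustering_of_starWindowBoundZdR_geometric_sharp` — `PerturbedClustering d N β W supp (log(1/ρ)/(D+2)) (8N/ρ)`;
* `uniformMassGapOnBallZdG_of_robustStar_variance_geometric_sharp` — the uniform currency on ds-2's gauge-invariant ball through the
  variance-form robust star door with rate `log(1/ρ₀)/(max R 1 + 4)` and constant `8N/ρ₀` (`0 < ρ₀ < 1`);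
* `su2_uniformMassGapOnBallZdG_star_geometric_sharp` (schema) and the legible cell
  `su2_uniformStar_oneEighth_quarterRadius_geometric_sharp`: `(β_W; ε₀, ε₁) = (1/8; 37/500, 37/1000)`, received sum `≤ 7/20` ⇒
  rate `log(20/7)/(max R 1 + 4)` (`≈ 1.050/…`; the `½`-floor cell: `log 2 ≈ 0.693/…`), constant `320/7 (< 46) · n²`.
For certificates with `ρ₀ ≥ ½` nothing changes (use `StarDoorZdGeometric.lean`).
WHAT THIS IS NOT: still one-sided comparison rates in units of the door's locality radius; lattice strong coupling only; nothing about
the continuum limit or a Clay-sense mass gap.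
-/

noncomputable section

open MeasureTheory ProbabilityTheory Function Finset Real
open scoped NNReal
open Literature.Probability.LatticeModels
open Literature.Probability.LatticeModels.DobrushinMetric (IsLipBound)
open Literature.MathematicalPhysics.QuantumLattice
open Literature.MathematicalPhysics.QuantumFieldTheory hiding ZdEdge Site
open Summit.QuantumFields.BalabanUV.InfraRed.StrongCouplingPoincareDoorSUN (OneLinkPoincareSUN)
open Summit.QuantumFields.BalabanUV.InfraRed.StrongCouplingVarianceDoorSUN (OneLinkVarianceBound)
open Summit.Ventures.YMGap.DSWindowZd
open Summit.Ventures.YMGap.StarResolventDim (Delta gaugeR doorPoly gaugeR_lt_one_of_door)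

namespace Summit.Ventures.YMGap.RobustBall

variable {d N : ℕ}

/-! ### The door at the geometric rate, no floor -/

/-- **Explicit clustering data from a star window bound, GEOMETRIC RATE, NO `½` FLOOR**: for a member with continuous own-link terms
supported by `supp` with range `R`, a star window bound for `perturbedYM (fundamentalRep (Fin N)) (N β) W supp` with locality radius
`D ≥ R + 2` and received sum `0 < ρ < 1` gives `PerturbedClustering d N β W supp (log(1/ρ)/(D+2)) (8N/ρ)`
(`ρ^{⌊x⌋} ≤ ρ^{x−1} = (1/ρ) e^{−log(1/ρ) x}`). -/
theorem perturbedClustering_of_starWindowBoundZdR_geometric_sharp {β ρ : ℝ} {R D : ℕ}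
    {W : Potential (ZdEdge d) (SUN N)} (hWc : ∀ X, Continuous (W X))
    (hWdep : ∀ X, DependsOn (W X) (↑X : Set (ZdEdge d)))
    {supp : Finset (ZdEdge d) → Finset (Finset (ZdEdge d))} (hsupp : W.IsSupportedBy supp)
    (hR : ∀ e, ∀ X ∈ supp {e}, e ∈ X → ∀ y ∈ X, ‖e.1 - y.1‖ ≤ (R : ℝ)) (hD : R + 2 ≤ D)
    (hρ0 : 0 < ρ) (hρ1 : ρ < 1)
    (h : StarWindowBoundZdR d N (perturbedYM (d := d) (fundamentalRep (Fin N)) (N * β) W supp) D ρ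
      suFrobDist) :
    PerturbedClustering d N β W supp (-Real.log ρ / (D + 2 : ℕ)) (8 * N / ρ) := by
  -- adapted from `perturbedClustering_of_starWindowBoundZdR_geometric` (same file family), with `ρ' = ρ` and `e^{κ} = 1/ρ`
  classical
  haveI : SecondCountableTopology (Matrix (Fin N) (Fin N) ℂ) :=
    inferInstanceAs (SecondCountableTopology (Fin N → Fin N → ℂ))
  haveI : SecondCountableTopology (SUN N) := Topology.IsEmbedding.subtypeVal.secondCountableTopology
  have hW : W.IsAdapted := fun X => ⟨hWdep X, (hWc X).measurable⟩
  have hWb : ∀ X, ∃ C, ∀ U, |W X U| ≤ C := fun X => exists_bound_of_continuous (hWc X)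
  have hγ : IsSpecification (perturbedYM (d := d) (fundamentalRep (Fin N)) (N * β) W supp) :=
    isSpecification_perturbedYM _ (continuous_fundamentalRep (Fin N)) _ hW hWb hsupp
  have hD1 : 1 ≤ D := by omega
  have hloc : ∀ (c : ZdEdge d) (ζ ζ' : LGConfig d (SUN N)), (∀ v ∈ starNbhdZdR D c.1, ζ v = ζ' v) →
      ∀ (f : LGConfig d (SUN N) → ℝ), Measurable f → (∃ B, ∀ σ, |f σ| ≤ B) →
        DependsOn f (starWinZd c : Set (ZdEdge d)) →
        ∫ σ, f σ ∂(perturbedYM (d := d) (fundamentalRep (Fin N)) (N * β) W supp (starWinZd c) ζ) =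
          ∫ σ, f σ ∂(perturbedYM (d := d) (fundamentalRep (Fin N)) (N * β) W supp (starWinZd c) ζ') :=
    fun c ζ ζ' hζ f hfm _ hfdep => perturbed_star_hloc _ (continuous_fundamentalRep (Fin N)) _
      (fun X => (hWc X).measurable) hWdep hsupp hR hD c ζ ζ' hζ f hfm hfdep
  intro μ hμ n F₁ F₂ Λ₁ Λ₂ K₁ K₂ h₁ h₂ _ hF₁ hF₂
  set κ : ℝ := -Real.log ρ with hκ
  have hκ0 : 0 ≤ κ := by rw [hκ, neg_nonneg]; exact Real.log_nonpos hρ0.le hρ1.le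
  have hD2 : (0 : ℝ) < ((D + 2 : ℕ) : ℝ) := by positivity
  have hμ' : IsGibbsMeasure (perturbedYM (d := d) (fundamentalRep (Fin N)) (N * β) W supp) μ := hμ
  haveI := hμ'.isProbabilityMeasure
  have hA : ∀ a b : SUN N, dist (suEntries a) (suEntries b) ≤ 1 * suFrobDist a b := fun a b => by
    rw [one_mul]; exact dist_suEntries_le_suFrobDist a b
  have key := abs_covariance_le_of_starWindowBoundZdR_geometric hγ hD1 hloc hρ0.le hρ1 h hμ'
    hF₁.measurable hF₂.measurable hF₁.abs_le hF₂.abs_le hF₁.dependsOn hF₂.dependsOn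
    (hF₁.isLipBound zero_le_one hA) (hF₂.isLipBound zero_le_one hA)
  have hK₁ : (0 : ℝ) ≤ K₁ := K₁.2
  have hK₂ : (0 : ℝ) ≤ K₂ := K₂.2
  have hn₁ : (Λ₁.card : ℝ) ≤ n := by exact_mod_cast h₁
  have hn₂ : (Λ₂.card : ℝ) ≤ n := by exact_mod_cast h₂
  have hsum₁ : ∑ y ∈ Λ₁, (if y ∈ Λ₁ then 1 * (K₁ : ℝ) else 0) ≤ n * K₁ := by
    rw [Finset.sum_ite_of_true (fun y hy => hy), Finset.sum_const, nsmul_eq_mul, one_mul]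
    exact mul_le_mul_of_nonneg_right hn₁ hK₁
  have hsum₂ : ∑ y ∈ Λ₂, (if y ∈ Λ₂ then 1 * (K₂ : ℝ) else 0) ≤ n * K₂ := by
    rw [Finset.sum_ite_of_true (fun y hy => hy), Finset.sum_const, nsmul_eq_mul, one_mul]
    exact mul_le_mul_of_nonneg_right hn₂ hK₂
  have hsum₁0 : 0 ≤ ∑ y ∈ Λ₁, (if y ∈ Λ₁ then 1 * (K₁ : ℝ) else 0) :=
    Finset.sum_nonneg fun y hy => by rw [if_pos hy]; positivity
  -- `ρ^{⌊x⌋} = e^{−κ ⌊x⌋} ≤ e^{κ} e^{−(κ/(D+2)) dist} = (1/ρ) e^{−(κ/(D+2)) dist}`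
  have hpow : ρ ^ ⌊setDistEdges Λ₁ Λ₂ / (D + 2 : ℕ)⌋₊ =
      Real.exp (-(κ * ⌊setDistEdges Λ₁ Λ₂ / (D + 2 : ℕ)⌋₊)) := by
    rw [hκ, neg_mul, neg_neg, mul_comm, Real.exp_nat_mul, Real.exp_log hρ0]
  have hgeom : Real.exp (-(κ * ⌊setDistEdges Λ₁ Λ₂ / (D + 2 : ℕ)⌋₊)) ≤
      Real.exp κ * Real.exp (-(κ / (D + 2 : ℕ)) * setDistEdges Λ₁ Λ₂) := by
    rw [← Real.exp_add]
    refine Real.exp_le_exp.2 ?_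
    have hfl : setDistEdges Λ₁ Λ₂ / (D + 2 : ℕ) - 1 ≤ (⌊setDistEdges Λ₁ Λ₂ / (D + 2 : ℕ)⌋₊ : ℝ) := by
      have := Nat.lt_floor_add_one (setDistEdges Λ₁ Λ₂ / (D + 2 : ℕ))
      linarith
    have := mul_le_mul_of_nonneg_left hfl hκ0
    have e1 : -(κ / (D + 2 : ℕ)) * setDistEdges Λ₁ Λ₂ = -(κ * (setDistEdges Λ₁ Λ₂ / (D + 2 : ℕ))) := by
      field_simp
    rw [e1]
    linarith
  have hexpκ : Real.exp κ = 1 / ρ := by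
    rw [hκ, Real.exp_neg, Real.exp_log hρ0, one_div]
  have h8 : (2 * (2 * Real.sqrt N) ^ 2 : ℝ) = 8 * N := by
    rw [mul_pow, Real.sq_sqrt (Nat.cast_nonneg _)]; ring
  calc |cov[F₁, F₂; μ]|
      ≤ 2 * (2 * Real.sqrt N) ^ 2 * ρ ^ ⌊setDistEdges Λ₁ Λ₂ / (D + 2 : ℕ)⌋₊ *
          (∑ y ∈ Λ₁, (if y ∈ Λ₁ then 1 * (K₁ : ℝ) else 0)) *
          ∑ y ∈ Λ₂, (if y ∈ Λ₂ then 1 * (K₂ : ℝ) else 0) := key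
    _ = 2 * (2 * Real.sqrt N) ^ 2 * Real.exp (-(κ * ⌊setDistEdges Λ₁ Λ₂ / (D + 2 : ℕ)⌋₊)) *
          (∑ y ∈ Λ₁, (if y ∈ Λ₁ then 1 * (K₁ : ℝ) else 0)) *
          ∑ y ∈ Λ₂, (if y ∈ Λ₂ then 1 * (K₂ : ℝ) else 0) := by rw [hpow]
    _ ≤ 2 * (2 * Real.sqrt N) ^ 2 * (Real.exp κ * Real.exp (-(κ / (D + 2 : ℕ)) * setDistEdges Λ₁ Λ₂)) *
          (n * K₁) * (n * K₂) := by gcongr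
    _ = 8 * N / ρ * (n : ℝ) ^ 2 * Real.exp (-(κ / (D + 2 : ℕ)) * setDistEdges Λ₁ Λ₂) *
          ((K₁ : ℝ) * K₂) := by rw [hexpκ, h8]; ring
    _ ≤ 8 * N / ρ * (n : ℝ) ^ 2 * Real.exp (-(κ / (D + 2 : ℕ)) * setDistEdges Λ₁ Λ₂) *
          ((K₁ : ℝ) * K₂ + Real.sqrt (∫ U, F₁ U ^ 2 ∂μ) * Real.sqrt (∫ U, F₂ U ^ 2 ∂μ)) := by
        gcongr
        exact le_add_of_nonneg_right (by positivity)

/-- **THE UNIFORM CURRENCY THROUGH THE VARIANCE-FORM ROBUST STAR DOOR, GEOMETRIC RATE, NO `½` FLOOR** (hypotheses of ds-2's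
`massGapOnBallZdG_of_robustStar_variance`, `ρ ≤ ρ₀`, `0 < ρ₀ < 1`):
`UniformMassGapOnBallZdG d N β ε₀ ε₁ R (log(1/ρ₀)/(max R 1 + 4)) (8N/ρ₀)`. -/
theorem uniformMassGapOnBallZdG_of_robustStar_variance_geometric_sharp (hd : 2 ≤ d) (hN : 1 ≤ N)
    {β ε₀ ε₁ b cP v c lam θ ρ ρ₀ : ℝ} {R Kn : ℕ} (hcP : 0 ≤ cP) (hv : 0 ≤ v)
    (hb : |(N : ℝ) * β| / N * (2 * ((d : ℝ) - 1)) ≤ b) (hP : OneLinkPoincareSUN N b cP)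
    (hVB : OneLinkVarianceBound N b v) (hε₁ : 0 ≤ ε₁) (hc : Real.exp ε₀ * Real.sqrt (cP * v) * (|(N : ℝ) * β| / N) ≤ c)
    (hlam : Real.exp (ε₀ / 2) * Real.sqrt cP * ε₁ ≤ lam) (hθ : θ = (2 * (d : ℝ) - 2) * c + lam) (hθ1 : θ < 1)
    (hcd : doorPoly d c < 1) (hρ : ρ = gaugeR d c + (lam + θ ^ Kn * (4 * d * lam)) / (1 - θ)) (hρle : ρ ≤ ρ₀)
    (hρ₀0 : 0 < ρ₀) (hρ1 : ρ₀ < 1) :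
    UniformMassGapOnBallZdG d N β ε₀ ε₁ R (-Real.log ρ₀ / (max R 1 + 4 : ℕ)) (8 * N / ρ₀) := by
  have hDpos : (0 : ℝ) < ((max R 1 + 4 : ℕ) : ℝ) := by positivity
  have hrate : 0 < -Real.log ρ₀ := by rw [neg_pos]; exact Real.log_neg hρ₀0 hρ1
  refine ⟨div_pos hrate hDpos, fun W supp hW => ?_⟩
  have hwin := (starWindowBoundZdR_of_memBallZdG_variance hd hN hcP hv hb hP hVB hε₁ hc hlam hθ hθ1 hcd hρ hW).mono_rho
    hρle
  have hD : R + 2 ≤ max R 1 + 2 := by omega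
  refine ⟨(perturbedMassGapAt_of_starWindowBoundZdR hW.continuous hW.dependsOn hW.supportedBy hW.range hD hρ₀0.le
      hρ1 hwin).1, ?_⟩
  have hcl := perturbedClustering_of_starWindowBoundZdR_geometric_sharp hW.continuous hW.dependsOn hW.supportedBy hW.range hD
    hρ₀0 hρ1 hwin
  have e4 : (max R 1 + 2 + 2 : ℕ) = max R 1 + 4 := by omega
  rw [e4] at hcl
  exact hcl

/-! ### `SU(2)`, `d = 4`: schema and the `β_W = 1/8` quarter-radius cell without the floor -/

/-- **SCHEMA, `SU(2)`, `d = 4`, GEOMETRIC RATE, NO FLOOR** (hypotheses of `su2_uniformMassGapOnBallZdG_star`, plus `0 < ρ₀`):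
`UniformMassGapOnBallZdG 4 2 (β_W/4) ε₀ ε₁ R (log(1/ρ₀)/(max R 1 + 4)) (16/ρ₀)`. -/
theorem su2_uniformMassGapOnBallZdG_star_geometric_sharp (Kn : ℕ) {βW ε₀ ε₁ c lam E S ρ₀ : ℝ} (hβ0 : 0 ≤ βW)
    (hβ : βW ≤ 2 / 3) (hε₁ : 0 ≤ ε₁) (hE : Real.exp ε₀ ≤ E) (hS : Real.sqrt 2 ≤ S)
    (hc : E * (1 + 2 * S * ε₁) * (βW / 4) ≤ c) (hlam : S * ε₁ ≤ lam) (hθ1 : 6 * c + lam < 1) (hcd : doorPoly 4 c < 1)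
    (hρ0 : gaugeR 4 c + (lam + (6 * c + lam) ^ Kn * (16 * lam)) / (1 - (6 * c + lam)) ≤ ρ₀) (hρ₀0 : 0 < ρ₀) (hρ1 : ρ₀ < 1)
    (R : ℕ) : UniformMassGapOnBallZdG 4 2 (βW / 4) ε₀ ε₁ R (-Real.log ρ₀ / (max R 1 + 4 : ℕ)) (16 / ρ₀) := by
  -- adapted from `su2_uniformMassGapOnBallZdG_star` (variance form: `su2_oneLinkPair`)
  have hS0 : 0 ≤ S := (Real.sqrt_nonneg _).trans hS
  have hE0 : 0 ≤ E := (Real.exp_pos _).le.trans hE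
  set θ : ℝ := 6 * c + lam with hθ
  set ρ : ℝ := gaugeR 4 c + (lam + θ ^ Kn * (16 * lam)) / (1 - θ) with hρ
  have habs : |((2 : ℕ) : ℝ) * (βW / 4)| / ((2 : ℕ) : ℝ) = βW / 4 := by
    rw [abs_of_nonneg (by positivity)]
    push_cast
    ring
  have h16 : (16 / ρ₀ : ℝ) = 8 * ((2 : ℕ) : ℝ) / ρ₀ := by norm_num
  rw [h16]
  have h := su2_uniformMassGapOnBallZdG_star_geometric Kn hβ0 hβ hε₁ hE hS hc hlam hθ1 hcd hρ0 hρ1 R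
  -- we re-enter through the variance door exactly as the floor version does, via its modulus twin's hypotheses;
  -- the shortest rigorous route: the floor version's FIRST component (uniqueness) and the sharp clustering from the window bound.
  refine ⟨?_, fun W supp hW => ⟨(h.2 W supp hW).1, ?_⟩⟩
  · have hDpos : (0 : ℝ) < ((max R 1 + 4 : ℕ) : ℝ) := by positivity
    exact div_pos (by rw [neg_pos]; exact Real.log_neg hρ₀0 hρ1) hDpos
  · have hR : |((2 : ℕ) : ℝ) * (βW / 4)| / ((2 : ℕ) : ℝ) * (2 * (((4 : ℕ) : ℝ) - 1)) ≤ 3 * βW / 2 := by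
      rw [habs]; push_cast; linarith
    have hc' : (1 : ℝ) * Real.exp ε₀ * (1 + 2 * Real.sqrt ((2 : ℕ) : ℝ) * ε₁) *
        (|((2 : ℕ) : ℝ) * (βW / 4)| / ((2 : ℕ) : ℝ)) ≤ c := by
      refine le_trans ?_ hc
      have h1 : Real.sqrt ((2 : ℕ) : ℝ) = Real.sqrt 2 := by norm_num
      rw [h1, one_mul, habs]
      have hb : 0 ≤ βW / 4 := by positivity
      calc Real.exp ε₀ * (1 + 2 * Real.sqrt 2 * ε₁) * (βW / 4) ≤ E * (1 + 2 * Real.sqrt 2 * ε₁) * (βW / 4) := by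
            gcongr
        _ ≤ E * (1 + 2 * S * ε₁) * (βW / 4) := by gcongr
    have hlam' : Real.sqrt ((2 : ℕ) : ℝ) * ε₁ ≤ lam := by
      have h1 : Real.sqrt ((2 : ℕ) : ℝ) = Real.sqrt 2 := by norm_num
      rw [h1]; exact le_trans (mul_le_mul_of_nonneg_right hS hε₁) hlam
    have hθ' : θ = (2 * ((4 : ℕ) : ℝ) - 2) * c + lam := by rw [hθ]; push_cast; ring
    have hρ' : ρ = gaugeR 4 c + (lam + θ ^ Kn * (4 * ((4 : ℕ) : ℝ) * lam)) / (1 - θ) := by rw [hρ]; push_cast; ring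
    have hwin := (starWindowBoundZdR_of_memBallZdG (d := 4) (N := 2) (by norm_num) (by norm_num) zero_le_one hR
      (su2_quarterModulus hβ) hε₁ hc' hlam' hθ' hθ1 hcd hρ' hW).mono_rho hρ0
    have hD : R + 2 ≤ max R 1 + 2 := by omega
    have hcl := perturbedClustering_of_starWindowBoundZdR_geometric_sharp hW.continuous hW.dependsOn hW.supportedBy hW.range hD
      hρ₀0 hρ1 hwin
    have e4 : (max R 1 + 2 + 2 : ℕ) = max R 1 + 4 := by omega
    rw [e4] at hcl
    exact hcl

/-- ★ **CELL `β_W = 1/8`, QUARTER RADIUS `(37/500, 37/1000)`, NO FLOOR**: received sum `≤ 7/20` ⇒ EVERY member of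
`MemBallZdG (37/500) (37/1000) R` at 't Hooft `1/32` has one DLR state clustering at rate `log(20/7)/(max R 1 + 4)` (`≈ 1.050/…`)
with constant `(320/7) n²` (the floor cell `su2_uniformStar_oneEighth_quarterRadius_geometric`: `log 2/…`, `32 n²`). -/
theorem su2_uniformStar_oneEighth_quarterRadius_geometric_sharp (R : ℕ) :
    UniformMassGapOnBallZdG 4 2 (1 / 32) (37 / 500) (37 / 1000) R (Real.log (20 / 7) / (max R 1 + 4 : ℕ)) (320 / 7) := by
  have e1 : (1 / 8 : ℝ) / 4 = 1 / 32 := by norm_num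
  have h := su2_uniformMassGapOnBallZdG_star_geometric_sharp 20 (βW := 1 / 8) (ε₀ := 37 / 500) (ε₁ := 37 / 1000)
    (c := 9293 / 250000) (lam := 52327 / 1000000) (ρ₀ := 7 / 20) (by norm_num) (by norm_num) (by norm_num)
    (exp_le_taylor4 (x := 37 / 500) (by norm_num) (by norm_num)) sqrt_two_le (by norm_num) (by norm_num)
    (by norm_num) (by unfold doorPoly; norm_num) (by unfold gaugeR Delta; norm_num) (by norm_num) (by norm_num) R
  rw [e1] at h
  have hlog : -Real.log (7 / 20 : ℝ) = Real.log (20 / 7) := by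
    rw [← Real.log_inv]; norm_num
  have hc : (16 / (7 / 20 : ℝ)) = 320 / 7 := by norm_num
  rw [hlog, hc] at h
  exact h

end Summit.Ventures.YMGap.RobustBall

end
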